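import Summits.QuantumFields.BalabanUV.T4Continuum.Spine.NE1p.DressedOutputAnalytic
import Summits.QuantumFields.BalabanUV.T4Continuum.Spine.NE1p.DressedSmallFieldPencilWitness

/-!
# T⁴ programme, spine estimate NE1′ (node O3b/H2) — WITNESS W26: THE JOINT (SOURCE, BACKGROUND) FACE FIRES — owner node N0n
# `DressedOutputAnalytic` (p220982) INHABITED on W23's two-cube catalogue by a BACKGROUND-MODULATED activity, its three ENDs reached
# BY NAME, the output GENUINELY non-constant in the source AND in the background

Cell `pub-balaban`, sub-cell `t4`, row NE1′ formalisation crew (`t4/formal/NE1p/LEAVES.md` row W26; INTENT journal 2026-08-20T15:00Z), unit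
`b2b-balaban-t4-ne1p-formalise-leaf-06` (gen 7); BOOKED typer R-T98 (v).  ADDITIVE — imports N0n `Spine/NE1p/DressedOutputAnalytic` (p220982) and
W23 `Spine/NE1p/DressedSmallFieldPencilWitness` (p221160) ONLY; THEOREMS ONLY — 0 `def` (the joint activity is written INLINE), 0 `def … : Prop`, 0 cite,
0 sorry.  Nothing of N0n or W23 is restated: every socket is W23's named lemma, every END is ONE application of an N0n theorem, liveness is W23's
`Z₂_moves` ∕ `sum_locE₂_live` BY NAME at the effective source.

WHAT THIS FILE DOES.  N0n records B13 p. 15's analyticity sentence as a kernel implication over an ARBITRARY complex normed parameter space `P`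
(`differentiableOn_locE_param`, open set `U`), the (1.18)-TYPE pair «analytic on `U` + bounded by the (2.41) envelope there»
(`analytic_and_bounded_locE_param`), and JOINT holomorphy in (source, background) on `ball 0 μ₁ ×ˢ W` for `P = ℂ × B`
(`differentiableOn_locE_source_background` — the analyticity half of the births binder (w1) for REGENERATED generations).  Every landed or booked
inhabitant of the crew (W23's one-∕two-cube source pencils, W24's torus face, W25's strength-pencil run) has parameter space `P = ℂ` = the SOURCE
alone; N0n's general `P`, its `IsOpen U` socket, the product set and the BACKGROUND space `B` were exercised by no inhabitant.  Here:
* §1 THE DATUM — on W23's two-cube catalogue (`Pol`, footprints `cubes₂`, tree length `d₂`, majorant `m₂ Z = (1∕12)·e^{−5 d Z}`, incompatibility =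
  footprint overlap `polyInc on cubes₂`; all of W23 §B's sockets BY NAME) the BACKGROUND-MODULATED activity `p ↦ act₂ ρ (p.1·p.2)`: source
  `p.1 ∈ ball 0 ρ`, background `p.2 ∈ ball 0 1 ⊂ ℂ =: B`, i.e. `act (s,u) Z = (s·u∕ρ)·m₂ Z`.  (E1) `hhol_joint`: JOINT Fréchet-differentiability on
  `ball 0 ρ ×ˢ ball 0 1` from the bilinear map `(s,u) ↦ s·u` on `ℂ × ℂ` (a two-variable statement, not a disc statement); (E2) `hm_joint`:
  `‖act (s,u) Z‖ ≤ m₂ Z` there (`‖s·u‖ ≤ ρ·1`, W23 `norm_act₂_le`).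
* §2 N0n FIRES, each END applied ONCE by name with every socket discharged: `jointFace_fires₂` (= `differentiableOn_locE_source_background` at
  `B := ℂ`, `W := ball 0 1`), `paramFace_fires₂` (= `differentiableOn_locE_param` at `P := ℂ × ℂ`, `U := ball 0 ρ ×ˢ ball 0 1`), `pair_fires₂`
  (= `analytic_and_bounded_locE_param`: holomorphy AND the envelope `e·1·1·(3∕2)²·(1∕12)·e⁻¹` at EVERY joint parameter), and the closed form
  `norm_locE_joint_le` : `‖E_{(s,u)}({0,1})‖ ≤ 3∕16` (W23 `envelope₂_eq` BY NAME — (2.41)'s decay `e^{−r₁ dX} = e⁻¹` live).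
* §3 GENUINE — the jointly holomorphic family of §2 is CONSTANT IN NEITHER VARIABLE: at a fixed live source `μ ≠ 0` the partition function and the
  output table `X ↦ E_{(μ,u)}(X)` at background `u ≠ 0` differ from those at background `0` (`jointZ_moves_with_background`,
  `jointOutput_moves_with_background`), and at a fixed live background `u ≠ 0` they differ between source `μ ≠ 0` and source `0`
  (`jointOutput_moves_with_source`) — W23's `Z₂_moves` ∕ `sum_locE₂_live` BY NAME at the effective source `μ·u ≠ 0`; a live point `(ρ∕2, 1∕2)` of the
  product domain is exhibited (`livePoint_mem`, `jointOutput_moves_at_livePoint`).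

HONEST FRAMING.  A DECIDED TOY inhabits N0n's hypothesis SHAPES with a TOY background (`B = ℂ`, the background a multiplier of the source); nothing of
Bałaban's `(𝐔, 𝐉)`-space, `𝐔^c_{k+1}(X, α₀, α₁)`, densities, (2.14) data, localization domains or value maps is instantiated; `hL3` (= (B3) = GAPS
G-ne9p2-5, UNPRINTED) is toy-true BY CHOICE of `m₂` (W23); the G^c-invariance ∕ chart-membership parts of (w1) are untouched; this file discharges NO wall
item and R-t4r2-Q2 is NOT met thereby; `3∕16` is W23's kernel number, no numeral is asserted from print.  NE1′ ⇐ the named binders — NOT proved, NOT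
printed; spine PROVED 0∕9; count 9 unchanged.  Rung (B)+1 on ONE finite four-torus — NOT infinite volume, NOT a mass gap, NOT OS on ℝ⁴, NOT Clay.
HONEST DEPENDENCY: continuum YM on T⁴ ⇐ BetaPertH ∧ nine spine estimates (0/9 proved); BetaPertH ⇐ (D1) ∧ (D4) ∧ CAP+tail; G-an2-4 gates asym,
D1 and NE2/3/4.
-/

noncomputable section

namespace Summit.QuantumFields.BalabanUV.T4Continuum.NE1p.DressedOutputAnalyticWitness

open Finset Metric Complex
open scoped Function
open Literature.MathematicalPhysics.QuantumFieldTheory.Balaban1983to89.B13Resummation (locE)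
open Literature.Probability.LatticeModels (polyInc polymerPartitionFunction)
open Summit.QuantumFields.BalabanUV.T4Continuum.NE1p.DressedOutputAnalytic
open Summit.QuantumFields.BalabanUV.T4Continuum.NE1p.DressedSmallFieldPencilWitness
open DressedSmallFieldPencilWitness.Pol

/-! ## §1 THE DATUM: W23's two-cube catalogue with a BACKGROUND-MODULATED activity `act (s,u) Z = act₂ ρ (s·u) Z = (s·u∕ρ)·m₂ Z` -/

/-- A joint parameter of the product domain has its source in the source disc: `0 < ρ` and `‖s·u‖ ≤ ρ` for `(s,u) ∈ ball 0 ρ ×ˢ ball 0 1`. -/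
theorem norm_mul_le_of_mem_prod {ρ : ℝ} {p : ℂ × ℂ} (hp : p ∈ ball (0 : ℂ) ρ ×ˢ ball (0 : ℂ) 1) : 0 < ρ ∧ ‖p.1 * p.2‖ ≤ ρ := by
  rw [Set.mem_prod, mem_ball_zero_iff, mem_ball_zero_iff] at hp
  refine ⟨(norm_nonneg _).trans_lt hp.1, ?_⟩
  rw [norm_mul]
  nlinarith [norm_nonneg p.1, norm_nonneg p.2, hp.1, hp.2]

/-- **Socket (E1) in the JOINT parameter** — `hhol`: for every polymer the background-modulated activity `(s,u) ↦ act₂ ρ (s·u) Z` is complex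
(Fréchet) differentiable on `ball 0 ρ ×ˢ ball 0 1 ⊂ ℂ × ℂ` (indeed on all of `ℂ × ℂ`: the bilinear map `(s,u) ↦ s·u` times constants). -/
theorem hhol_joint (ρ : ℝ) : ∀ Z : Pol, cubes₂ Z ⊆ univ →
    DifferentiableOn ℂ (fun p : ℂ × ℂ => act₂ ρ (p.1 * p.2) Z) (ball (0 : ℂ) ρ ×ˢ ball (0 : ℂ) 1) := fun Z _ => by
  unfold act₂
  exact (by fun_prop : Differentiable ℂ fun p : ℂ × ℂ => p.1 * p.2 / (ρ : ℂ) * (m₂ Z : ℂ)).differentiableOn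

/-- **Socket (E2) in the JOINT parameter** — `hm`: `‖act₂ ρ (s·u) Z‖ ≤ m₂ Z` on `ball 0 ρ ×ˢ ball 0 1` (W23 `norm_act₂_le` at the effective source
`s·u`, `‖s·u‖ ≤ ρ`). -/
theorem hm_joint {ρ : ℝ} : ∀ p ∈ ball (0 : ℂ) ρ ×ˢ ball (0 : ℂ) 1, ∀ Z : Pol, cubes₂ Z ⊆ univ → ‖act₂ ρ (p.1 * p.2) Z‖ ≤ m₂ Z :=
  fun _ hp Z _ => (norm_mul_le_of_mem_prod hp).elim fun hρ hs => norm_act₂_le hρ hs Z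

/-! ## §2 N0n FIRES on the datum — each END applied ONCE, BY NAME, every socket discharged by a named lemma of W23 §B -/

/-- **N0n `differentiableOn_locE_source_background` FIRES** (background space `B := ℂ`, `W := ball 0 1`, `IsOpen W` by `isOpen_ball`): the localized
output `(s,u) ↦ E_{(s,u)}({0,1})` of the background-modulated two-cube catalogue is JOINTLY complex differentiable in (source, background) on
`ball 0 ρ ×ˢ ball 0 1`. -/
theorem jointFace_fires₂ (ρ : ℝ) :
    DifferentiableOn ℂ (fun p : ℂ × ℂ => locE (polyInc on cubes₂) cubes₂ (fun Z => act₂ ρ (p.1 * p.2) Z) univ)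
      (ball (0 : ℂ) ρ ×ˢ ball (0 : ℂ) 1) :=
  differentiableOn_locE_source_background (polyInc on cubes₂) (B := ℂ) (reach := cubes₂) (d := d₂) (m := m₂)
    (act := fun p Z => act₂ ρ (p.1 * p.2) Z) (A := 1 / 12) (R := 5) (r₁ := 1) (κ₀ := 1) (K₀ := 3 / 2) (c₁ := 1) (c := 1) (b := 1) (ν := 1)
    (μ₁ := ρ) (X := univ) (W := ball (0 : ℂ) 1) isOpen_ball hloc₂ (fun Z => by rw [one_mul]) hd₂ (by norm_num) (by norm_num) (by norm_num)
    (by norm_num) (by norm_num) (by norm_num) (by norm_num) h126₂ hvol₂ (by norm_num) hsmall₂ (hhol_joint ρ) hm_joint hL3₂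

/-- **N0n `differentiableOn_locE_param` FIRES with a GENUINELY two-dimensional parameter** (`P := ℂ × ℂ`, `U := ball 0 ρ ×ˢ ball 0 1`, `IsOpen U` by
`isOpen_ball.prod isOpen_ball`): the same conclusion through the general-parameter END. -/
theorem paramFace_fires₂ (ρ : ℝ) :
    DifferentiableOn ℂ (fun p : ℂ × ℂ => locE (polyInc on cubes₂) cubes₂ (fun Z => act₂ ρ (p.1 * p.2) Z) univ)
      (ball (0 : ℂ) ρ ×ˢ ball (0 : ℂ) 1) :=
  differentiableOn_locE_param (polyInc on cubes₂) (P := ℂ × ℂ) (reach := cubes₂) (d := d₂) (m := m₂)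
    (act := fun p Z => act₂ ρ (p.1 * p.2) Z) (A := 1 / 12) (R := 5) (r₁ := 1) (κ₀ := 1) (K₀ := 3 / 2) (c₁ := 1) (c := 1) (b := 1) (ν := 1)
    (X := univ) (U := ball (0 : ℂ) ρ ×ˢ ball (0 : ℂ) 1) (isOpen_ball.prod isOpen_ball) hloc₂ (fun Z => by rw [one_mul]) hd₂ (by norm_num)
    (by norm_num) (by norm_num) (by norm_num) (by norm_num) (by norm_num) (by norm_num) h126₂ hvol₂ (by norm_num) hsmall₂ (hhol_joint ρ)
    hm_joint hL3₂

/-- **N0n `analytic_and_bounded_locE_param` FIRES — THE (1.18)-TYPE PAIR**: holomorphy on the product domain AND, at EVERY joint parameter there, the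
(2.41) envelope `e·1·1·(3∕2)²·(1∕12)·e^{−1·1}` (decay live: `r₁ = dX = 1`; `Ineq227` at `c = 1` = W23 `h227₂`). -/
theorem pair_fires₂ (ρ : ℝ) :
    DifferentiableOn ℂ (fun p : ℂ × ℂ => locE (polyInc on cubes₂) cubes₂ (fun Z => act₂ ρ (p.1 * p.2) Z) univ)
        (ball (0 : ℂ) ρ ×ˢ ball (0 : ℂ) 1) ∧
      ∀ p ∈ ball (0 : ℂ) ρ ×ˢ ball (0 : ℂ) 1,
        ‖locE (polyInc on cubes₂) cubes₂ (fun Z => act₂ ρ (p.1 * p.2) Z) univ‖ ≤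
          Real.exp 1 * 1 * 1 * (3 / 2) ^ 2 * (1 / 12) * Real.exp (-(1 * 1)) :=
  analytic_and_bounded_locE_param (polyInc on cubes₂) (P := ℂ × ℂ) (reach := cubes₂) (d := d₂) (m := m₂)
    (act := fun p Z => act₂ ρ (p.1 * p.2) Z) (A := 1 / 12) (R := 5) (r₁ := 1) (κ₀ := 1) (K₀ := 3 / 2) (c₁ := 1) (c := 1) (b := 1) (ν := 1)
    (dX := 1) (X := univ) (U := ball (0 : ℂ) ρ ×ˢ ball (0 : ℂ) 1) (isOpen_ball.prod isOpen_ball) hloc₂ (fun Z => by rw [one_mul]) hd₂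
    (by norm_num) (by norm_num) (by norm_num) (by norm_num) (by norm_num) (by norm_num) (by norm_num) (by norm_num) h126₂ hvol₂ h227₂
    (by norm_num) hsmall₂ univ_nonempty (hhol_joint ρ) hm_joint hL3₂

/-- The bound half in closed form: `‖E_{(s,u)}({0,1})‖ ≤ 3∕16` at every joint parameter of the product domain (W23 `envelope₂_eq` BY NAME). -/
theorem norm_locE_joint_le {ρ : ℝ} {p : ℂ × ℂ} (hp : p ∈ ball (0 : ℂ) ρ ×ˢ ball (0 : ℂ) 1) :
    ‖locE (polyInc on cubes₂) cubes₂ (fun Z => act₂ ρ (p.1 * p.2) Z) univ‖ ≤ 3 / 16 :=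
  envelope₂_eq ▸ (pair_fires₂ ρ).2 p hp

/-! ## §3 GENUINE: the jointly holomorphic family is constant in NEITHER the source NOR the background -/

/-- **THE PARTITION FUNCTION MOVES WITH THE BACKGROUND AT A FIXED LIVE SOURCE**: for `(μ, u)` in the product domain with `μ ≠ 0`, `u ≠ 0`,
`Z(act (μ,u)) ≠ Z(act (μ,0))` (W23 `Z₂_moves` BY NAME at the effective source `μ·u ≠ 0`; `act (μ,0) = act₂ ρ 0`). -/
theorem jointZ_moves_with_background {ρ : ℝ} {μ u : ℂ} (hp : (μ, u) ∈ ball (0 : ℂ) ρ ×ˢ ball (0 : ℂ) 1) (hμ : μ ≠ 0) (hu : u ≠ 0) :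
    polymerPartitionFunction (polyInc on cubes₂) (fun Z => act₂ ρ ((μ, u).1 * (μ, u).2) Z) univ ≠
      polymerPartitionFunction (polyInc on cubes₂) (fun Z => act₂ ρ ((μ, (0 : ℂ)).1 * (μ, (0 : ℂ)).2) Z) univ := by
  obtain ⟨hρ, hs⟩ := norm_mul_le_of_mem_prod hp
  simp only [mul_zero]
  exact Z₂_moves hρ hs (mul_ne_zero hμ hu)

/-- **GENUINE — THE JOINT OUTPUT TABLE MOVES WITH THE BACKGROUND AT A FIXED LIVE SOURCE**: for `(μ, u)` in the product domain with `μ ≠ 0`,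
`u ≠ 0`, the table `X ↦ E_{(μ,u)}(X)` differs from `X ↦ E_{(μ,0)}(X)` at some union `X ⊆ {0,1}` (W23 `sum_locE₂_live` BY NAME at the effective source
`μ·u`) — the family of §2 is NOT constant in the background variable. -/
theorem jointOutput_moves_with_background {ρ : ℝ} {μ u : ℂ} (hp : (μ, u) ∈ ball (0 : ℂ) ρ ×ˢ ball (0 : ℂ) 1) (hμ : μ ≠ 0) (hu : u ≠ 0) :
    ∃ X : Finset (Fin 2), locE (polyInc on cubes₂) cubes₂ (fun Z => act₂ ρ ((μ, u).1 * (μ, u).2) Z) X ≠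
      locE (polyInc on cubes₂) cubes₂ (fun Z => act₂ ρ ((μ, (0 : ℂ)).1 * (μ, (0 : ℂ)).2) Z) X := by
  obtain ⟨hρ, hs⟩ := norm_mul_le_of_mem_prod hp
  simp only [mul_zero]
  exact sum_locE₂_live hρ hs (mul_ne_zero hμ hu)

/-- **… AND WITH THE SOURCE AT A FIXED LIVE BACKGROUND**: for `(μ, u)` in the product domain with `μ ≠ 0`, `u ≠ 0`, the table `X ↦ E_{(μ,u)}(X)`
differs from `X ↦ E_{(0,u)}(X)` at some union. -/
theorem jointOutput_moves_with_source {ρ : ℝ} {μ u : ℂ} (hp : (μ, u) ∈ ball (0 : ℂ) ρ ×ˢ ball (0 : ℂ) 1) (hμ : μ ≠ 0) (hu : u ≠ 0) :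
    ∃ X : Finset (Fin 2), locE (polyInc on cubes₂) cubes₂ (fun Z => act₂ ρ ((μ, u).1 * (μ, u).2) Z) X ≠
      locE (polyInc on cubes₂) cubes₂ (fun Z => act₂ ρ (((0 : ℂ), u).1 * ((0 : ℂ), u).2) Z) X := by
  obtain ⟨hρ, hs⟩ := norm_mul_le_of_mem_prod hp
  simp only [zero_mul]
  exact sum_locE₂_live hρ hs (mul_ne_zero hμ hu)

/-- A live point exists INSIDE the product domain: `(μ, u) = (ρ∕2, 1∕2)` for `0 < ρ` — so §2's three firings and the `3∕16` bound constrain a family that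
genuinely varies in both variables there. -/
theorem livePoint_mem {ρ : ℝ} (hρ : 0 < ρ) : (((ρ / 2 : ℝ) : ℂ), (1 / 2 : ℂ)) ∈ ball (0 : ℂ) ρ ×ˢ ball (0 : ℂ) 1 ∧ ((ρ / 2 : ℝ) : ℂ) ≠ 0 ∧
    (1 / 2 : ℂ) ≠ 0 := by
  refine ⟨Set.mk_mem_prod ?_ ?_, by exact_mod_cast (by positivity : (0 : ℝ) < ρ / 2).ne', by norm_num⟩
  · rw [mem_ball_zero_iff, Complex.norm_real, Real.norm_of_nonneg (by positivity)]; linarith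
  · rw [mem_ball_zero_iff]; norm_num

/-- At the live point: the joint output table at background `1∕2` differs from the one at background `0` (source `ρ∕2` fixed). -/
theorem jointOutput_moves_at_livePoint {ρ : ℝ} (hρ : 0 < ρ) :
    ∃ X : Finset (Fin 2), locE (polyInc on cubes₂) cubes₂ (fun Z => act₂ ρ (((ρ / 2 : ℝ) : ℂ) * (1 / 2 : ℂ)) Z) X ≠
      locE (polyInc on cubes₂) cubes₂ (fun Z => act₂ ρ (((ρ / 2 : ℝ) : ℂ) * 0) Z) X := by
  obtain ⟨hp, hμ, hu⟩ := livePoint_mem hρ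
  exact jointOutput_moves_with_background hp hμ hu

end Summit.QuantumFields.BalabanUV.T4Continuum.NE1p.DressedOutputAnalyticWitness

end
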